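import Summits.QuantumFields.YangMills.Theorems.ColdStartUniversalityLatticeLangevinRiemannW1ContractionCouplings
import Literature.MeasureTheory.OptimalTransport.KantorovichRubinstein
import HarnessLib

/-!
# Shen–Zhu–Zhu's Theorem 4.2 (4.5) WITH AN HONEST COUPLING, in `W₁`: for the `SU(2)` lattice Langevin dynamics on `(ℤ/L)³`, `|β'| < 1/12`,
# `W₁^{ρ_L}(δ_Q P_t, δ_{Q'} P_t) ≤ e^(−(1−12|β'|)t)·ρ_L(Q,Q')` and `W₁^{ρ_L}(νP_t, ν'P_t) ≤ e^(−(1−12|β'|)t)·W₁^{ρ_L}(ν,ν')`, uniformly in `L` —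
# the Literature's conclusion shape `SZZDiracContraction (fundamentalLatticeRep 2) 3 L β' ((1−12|β'|)/2) ρ_L`

Seat `ym-line-csu-p1` (g41), route `ColdStartUniversality` of `Summits/QuantumFields/YangMills`, helper file G58 (`--supports stmt-QuantumFields-24809`).
G54/G57 proved the Kantorovich (dual, Lipschitz-observable) side of the `W₁` contraction.  The tree's optimal-transport library
(`Literature.MeasureTheory.OptimalTransport.KantorovichRubinstein`: Kantorovich–Rubinstein duality with optimisers on a compact metric space, for every
continuous METRIC COST) converts it into the primal, coupling statement.  To apply it we equip `SU(2)^E` — inside the proofs only — with the metric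
`ρ_L = √torusRiemannDistSq` (a genuine metric by G45, inducing the product topology: chord `≤` arc per link), and take the cost `c = ρ_L`.

* ★ `isOpen_iff_riemannDist_ball` — the product topology of `SU(2)^E` is the `ρ_L`-metric topology;
* ★★★★ `wilson_szzWasserstein_W1_contraction` — for every realising kernel family `κ`, every `t`, `Q`, `Q'`:
  `szzWassersteinSq ρ_L (κ_t(Q,·)) (κ_t(Q',·)) ≤ ofReal(e^(−(1−12|β'|)t)·ρ_L(Q,Q'))` — an OPTIMAL COUPLING of the two time-`t` laws with mean
  `ρ_L`-distance at most `e^(−(1−12|β'|)t)·ρ_L(Q,Q')` exists (the tree's `szzWassersteinSq c` is the coupling infimum `inf_π ∫c dπ`; with the un-squared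
  cost `c = ρ_L` it is `W₁`);
* ★★★★ **`szzDiracContraction_W1_su2`** — `SZZDiracContraction (fundamentalLatticeRep 2) 3 L β' ((1 − 12|β'|)/2) (fun U U' ↦ ρ_L(U,U'))` for every `L`
  and `|β'| < 1/12`: Shen–Zhu–Zhu's (4.5) in the Literature's own conclusion shape, for ANY two strong solutions on ANY filtered probability spaces,
  with the cost `ρ_L` in place of `ρ_L²` (i.e. `W₁` in place of `W₂`) and rate `e^(−2Kt)`, `K = (1−12|β'|)/2 ≥ K_𝒮/2`;
* ★★★ `wilson_szzWasserstein_W1_contraction_of_initialLaws` — `W₁(νP_t, ν'P_t) ≤ e^(−(1−12|β'|)t)·W₁(ν,ν')` for all initial laws (both sides as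
  `szzWassersteinSq ρ_L`).

THEOREMS ONLY, no definition (the metric structure is a `letI` inside the proofs), no sorry.  HONEST FRAMING: this is the `W₁` (`p = 1`) version; the
PRINTED `W₂` statement (squared cost, named fact `shenZhuZhu_finiteVolumeErgodicity`) is NOT discharged (it would need Kuwada's duality / Hopf–Lax);
fixed cut-off, `|β'| < 1/12`; nothing `K`-uniform along the route's scaling; `UniformColdStartMixing` (24809, ASIDE) not restated; no crux, rung or
summit statement is proved; the Yang–Mills mass gap is NOT proved.
-/

set_option autoImplicit false

noncomputable section

namespace Summit.QuantumFields.YangMills.Theorems.ColdStartUniversality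

open MeasureTheory ProbabilityTheory Matrix Complex Finset Filter Topology Set
open scoped BigOperators NNReal ENNReal
open Literature.MathematicalPhysics.QuantumFieldTheory
open Literature.MathematicalPhysics.QuantumLattice (fundamentalRep fundamentalLatticeRep continuous_fundamentalRep fundamentalRep_apply fundamentalLatticeRep_N)

variable {L : ℕ} [NeZero L]

/-! ## §1. The product topology of `SU(2)^E` is the `ρ_L`-metric topology -/

/-- ★ **`ρ_L` induces the product topology**: a set of configurations is open iff it contains a `ρ_L`-ball around each of its points (balls are open
by continuity of `ρ_L`; conversely matrix entries are controlled by `ρ_L`, `tendsto_of_hsDist_tendsto_zero`). [cite: ShenZhuZhu2022, §4.1] -/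
theorem isOpen_iff_riemannDist_ball (s : Set (GaugeConfig 3 L (Matrix.specialUnitaryGroup (Fin 2) ℂ))) :
    IsOpen s ↔ ∀ x ∈ s, ∃ ε > 0, ∀ y : GaugeConfig 3 L (Matrix.specialUnitaryGroup (Fin 2) ℂ), Real.sqrt (torusRiemannDistSq (fundamentalLatticeRep 2) x y) < ε → y ∈ s := by
  constructor
  · intro hs x hx
    by_contra h
    push Not at h
    -- a sequence `y n ∉ s` with `ρ_L(x, y n) < 1/(n+1)` converges to `x`: contradiction
    have hch : ∀ n : ℕ, ∃ y : GaugeConfig 3 L (Matrix.specialUnitaryGroup (Fin 2) ℂ), Real.sqrt (torusRiemannDistSq (fundamentalLatticeRep 2) x y) < 1 / ((n : ℝ) + 1) ∧ y ∉ s :=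
      fun n => h (1 / ((n : ℝ) + 1)) (by positivity)
    choose y hy using hch
    have hlim : Tendsto y atTop (𝓝 x) := by
      refine tendsto_of_hsDist_tendsto_zero ?_
      have hb : ∀ n, ∑ e, hsForm 2 ((fundamentalRep (Fin 2) (y n e) : Matrix (Fin 2) (Fin 2) ℂ) - fundamentalRep (Fin 2) (x e))
          ((fundamentalRep (Fin 2) (y n e) : Matrix (Fin 2) (Fin 2) ℂ) - fundamentalRep (Fin 2) (x e)) ≤ (1 / ((n : ℝ) + 1)) ^ 2 := by
        intro n
        have h1 : ∑ e, hsForm 2 ((y n e : Matrix (Fin 2) (Fin 2) ℂ) - (x e : Matrix (Fin 2) (Fin 2) ℂ)) ((y n e : Matrix (Fin 2) (Fin 2) ℂ) - (x e : Matrix (Fin 2) (Fin 2) ℂ)) ≤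
            torusRiemannDistSq (fundamentalLatticeRep 2) x (y n) := sum_hsForm_sub_le_torusRiemannDistSq_two x (y n)
        have h2 : torusRiemannDistSq (fundamentalLatticeRep 2) x (y n) ≤ (1 / ((n : ℝ) + 1)) ^ 2 := by
          have h0 : 0 ≤ torusRiemannDistSq (fundamentalLatticeRep 2) x (y n) := by
            unfold torusRiemannDistSq; exact Finset.sum_nonneg fun _ _ => sq_nonneg _
          have := pow_le_pow_left₀ (Real.sqrt_nonneg _) (hy n).1.le 2
          rwa [Real.sq_sqrt h0] at this
        exact h1.trans h2
      have h0 : ∀ n, 0 ≤ ∑ e, hsForm 2 ((fundamentalRep (Fin 2) (y n e) : Matrix (Fin 2) (Fin 2) ℂ) - fundamentalRep (Fin 2) (x e))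
          ((fundamentalRep (Fin 2) (y n e) : Matrix (Fin 2) (Fin 2) ℂ) - fundamentalRep (Fin 2) (x e)) := fun n => Finset.sum_nonneg fun _ _ => hsForm_self_nonneg _
      have hlim0 : Tendsto (fun n : ℕ => (1 / ((n : ℝ) + 1)) ^ 2) atTop (𝓝 0) := by
        have h := (tendsto_one_div_add_atTop_nhds_zero_nat (𝕜 := ℝ)).pow 2
        rwa [zero_pow two_ne_zero] at h
      exact squeeze_zero h0 hb hlim0
    obtain ⟨n, hn⟩ := (hlim.eventually (hs.mem_nhds hx)).exists
    exact (hy n).2 hn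
  · intro h
    rw [isOpen_iff_mem_nhds]
    intro x hx
    obtain ⟨ε, hε, hball⟩ := h x hx
    have hopen : IsOpen {y : GaugeConfig 3 L (Matrix.specialUnitaryGroup (Fin 2) ℂ) | Real.sqrt (torusRiemannDistSq (fundamentalLatticeRep 2) x y) < ε} :=
      isOpen_lt (Real.continuous_sqrt.comp (continuous_torusRiemannDistSq_two_right x)) continuous_const
    have hxB : x ∈ {y : GaugeConfig 3 L (Matrix.specialUnitaryGroup (Fin 2) ℂ) | Real.sqrt (torusRiemannDistSq (fundamentalLatticeRep 2) x y) < ε} := by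
      simp only [Set.mem_setOf_eq, (torusRiemannDistSq_two_eq_zero_iff x x).2 rfl, Real.sqrt_zero]; exact hε
    exact Filter.mem_of_superset (hopen.mem_nhds hxB) fun y hy => hball y hy

/-! ## §2. `W₁` contraction with an optimal coupling -/

/-- ★★★★ **`W₁^{ρ_L}(κ_t(Q,·), κ_t(Q',·)) ≤ e^(−(1−12|β'|)t)·ρ_L(Q,Q')` with an honest coupling.**  For `|β'| < 1/12`, every `L`, every realising kernel
family `κ`, every `t ≥ 0` and all `Q, Q'`: the coupling infimum of the mean `ρ_L`-distance between the time-`t` laws (the tree's `szzWassersteinSq` with the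
un-squared cost `ρ_L`) is at most `e^(−(1−12|β'|)t)·ρ_L(Q,Q')` — Kantorovich–Rubinstein duality (tree, Villani Thm 1.14, optimal potential `ζ`, optimal
plan `π`) applied to the Lipschitz contraction of G54 for the `1`-Lipschitz observable `ζ`. [cite: ShenZhuZhu2022, Theorem 4.2 (4.5)] [cite: Villani2003, Thm. 1.14] -/
theorem wilson_szzWasserstein_W1_contraction (L : ℕ) [NeZero L] (Q Q' : GaugeConfig 3 L (Matrix.specialUnitaryGroup (Fin 2) ℂ)) (t : ℝ≥0) (β' : ℝ) (hβ : |β'| < 1 / 12)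
    (κ : ℝ≥0 → Kernel (GaugeConfig 3 L (Matrix.specialUnitaryGroup (Fin 2) ℂ))
      (GaugeConfig 3 L (Matrix.specialUnitaryGroup (Fin 2) ℂ))) [∀ t, IsMarkovKernel (κ t)]
    (hreal : ∀ (t : ℝ≥0) (x : GaugeConfig 3 L (Matrix.specialUnitaryGroup (Fin 2) ℂ))
        (Ω : Type) [MeasurableSpace Ω] (P : Measure Ω) [IsProbabilityMeasure P]
        (W : ℝ≥0 → Ω → (Edge 3 L × NoiseIdx 2 → ℝ)) (hW : IsFlatBrownian W P)
        (U : ℝ≥0 → Ω → GaugeConfig 3 L (Matrix.specialUnitaryGroup (Fin 2) ℂ)),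
        (∀ ω, U 0 ω = x) →
        (latticeLangevinDynamics (fundamentalLatticeRep 2) β').IsSolution (fundamentalRep (Fin 2))
          hW.natFiltration P W U →
        κ t x = P.map (U t))
    :
    szzWassersteinSq (fun U U' : GaugeConfig 3 L (Matrix.specialUnitaryGroup (Fin 2) ℂ) => Real.sqrt (torusRiemannDistSq (fundamentalLatticeRep 2) U U')) (κ t Q) (κ t Q') ≤
      ENNReal.ofReal (Real.exp (-((1 - 12 * |β'|) * (t : ℝ))) * Real.sqrt (torusRiemannDistSq (fundamentalLatticeRep 2) Q Q')) := by
  classical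
  haveI := secondCountableTopology_su2
  haveI := borelSpace_config L
  -- the metric `ρ_L`
  have hzero : ∀ x y : GaugeConfig 3 L (Matrix.specialUnitaryGroup (Fin 2) ℂ), Real.sqrt (torusRiemannDistSq (fundamentalLatticeRep 2) x y) = 0 ↔ x = y := fun x y => by
    have h0 : 0 ≤ torusRiemannDistSq (fundamentalLatticeRep 2) x y := by
      unfold torusRiemannDistSq; exact Finset.sum_nonneg fun _ _ => sq_nonneg _
    rw [Real.sqrt_eq_zero h0, torusRiemannDistSq_two_eq_zero_iff]
  have hself : ∀ x : GaugeConfig 3 L (Matrix.specialUnitaryGroup (Fin 2) ℂ), Real.sqrt (torusRiemannDistSq (fundamentalLatticeRep 2) x x) = 0 := fun x => (hzero x x).2 rfl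
  have hcomm : ∀ x y : GaugeConfig 3 L (Matrix.specialUnitaryGroup (Fin 2) ℂ), Real.sqrt (torusRiemannDistSq (fundamentalLatticeRep 2) x y) = Real.sqrt (torusRiemannDistSq (fundamentalLatticeRep 2) y x) :=
    fun x y => by rw [torusRiemannDistSq_two_comm]
  have htri : ∀ x y z : GaugeConfig 3 L (Matrix.specialUnitaryGroup (Fin 2) ℂ), Real.sqrt (torusRiemannDistSq (fundamentalLatticeRep 2) x z) ≤
      Real.sqrt (torusRiemannDistSq (fundamentalLatticeRep 2) x y) + Real.sqrt (torusRiemannDistSq (fundamentalLatticeRep 2) y z) :=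
    fun x y z => sqrt_torusRiemannDistSq_two_triangle x y z
  have hcont2 : Continuous fun p : (GaugeConfig 3 L (Matrix.specialUnitaryGroup (Fin 2) ℂ)) × (GaugeConfig 3 L (Matrix.specialUnitaryGroup (Fin 2) ℂ)) => Real.sqrt (torusRiemannDistSq (fundamentalLatticeRep 2) p.1 p.2) :=
    Real.continuous_sqrt.comp continuous_torusRiemannDistSq_two
  -- `SU(2)^E` as a compact metric space for `ρ_L`, with its given topology
  letI : MetricSpace (GaugeConfig 3 L (Matrix.specialUnitaryGroup (Fin 2) ℂ)) :=
    { __ := PseudoMetricSpace.ofDistTopology (fun x y : GaugeConfig 3 L (Matrix.specialUnitaryGroup (Fin 2) ℂ) => Real.sqrt (torusRiemannDistSq (fundamentalLatticeRep 2) x y))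
        hself hcomm htri isOpen_iff_riemannDist_ball,
      eq_of_dist_eq_zero := fun {x y} h => (hzero x y).1 h }
  -- the cost `c = ρ_L`
  let c : C((GaugeConfig 3 L (Matrix.specialUnitaryGroup (Fin 2) ℂ)) × (GaugeConfig 3 L (Matrix.specialUnitaryGroup (Fin 2) ℂ)), ℝ) := ⟨fun p => Real.sqrt (torusRiemannDistSq (fundamentalLatticeRep 2) p.1 p.2), hcont2⟩
  have hc : Literature.MeasureTheory.OptimalTransport.IsMetricCost c :=
    ⟨fun x => hself x, fun x y => hcomm x y, fun x y z => htri x y z⟩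
  -- Kantorovich–Rubinstein: optimal plan and optimal potential
  obtain ⟨π, ζ, hπ, hζ, heq, -, -, -⟩ :=
    Literature.MeasureTheory.OptimalTransport.exists_isCoupling_isKRPotential (μ := κ t Q) (ν := κ t Q') hc (by rw [measure_univ, measure_univ])
  -- the potential is `1`-Lipschitz for `ρ_L`, so G54 applies to it
  have hlip : ∀ P P' : GaugeConfig 3 L (Matrix.specialUnitaryGroup (Fin 2) ℂ), |ζ P' - ζ P| ≤ 1 * Real.sqrt (torusRiemannDistSq (fundamentalLatticeRep 2) P P') := fun P P' => by
    rw [one_mul, hcomm]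
    exact hζ.abs_sub_le hc P' P
  have hcontr := wilson_riemannLipschitz_contraction_allLipschitz L zero_le_one hlip Q Q' t β' hβ κ hreal
  have hcost : ∫ z, c z ∂π ≤ Real.exp (-((1 - 12 * |β'|) * (t : ℝ))) * Real.sqrt (torusRiemannDistSq (fundamentalLatticeRep 2) Q Q') := by
    rw [heq]
    have h := (le_abs_self _).trans hcontr
    rwa [mul_one] at h
  -- the plan is a coupling in the sense of `szzWassersteinSq`
  have hprob : IsProbabilityMeasure π := by
    constructor
    have h1 : π.map Prod.fst Set.univ = 1 := by rw [hπ.map_fst]; exact measure_univ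
    rwa [Measure.map_apply measurable_fst MeasurableSet.univ, Set.preimage_univ] at h1
  haveI := hprob
  have hπ' : Literature.Geometry.Riemannian.IsCoupling (κ t Q) (κ t Q') π := ⟨hprob, hπ.map_fst, hπ.map_snd⟩
  have hρi : Integrable (fun z : (GaugeConfig 3 L (Matrix.specialUnitaryGroup (Fin 2) ℂ)) × (GaugeConfig 3 L (Matrix.specialUnitaryGroup (Fin 2) ℂ)) => Real.sqrt (torusRiemannDistSq (fundamentalLatticeRep 2) z.1 z.2)) π :=
    hcont2.integrable_of_hasCompactSupport (HasCompactSupport.of_compactSpace _)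
  calc szzWassersteinSq (fun U U' : GaugeConfig 3 L (Matrix.specialUnitaryGroup (Fin 2) ℂ) => Real.sqrt (torusRiemannDistSq (fundamentalLatticeRep 2) U U')) (κ t Q) (κ t Q')
      ≤ ∫⁻ z, ENNReal.ofReal (Real.sqrt (torusRiemannDistSq (fundamentalLatticeRep 2) z.1 z.2)) ∂π := szzWassersteinSq_le _ hπ'
    _ = ENNReal.ofReal (∫ z, Real.sqrt (torusRiemannDistSq (fundamentalLatticeRep 2) z.1 z.2) ∂π) :=
        (ofReal_integral_eq_lintegral_ofReal hρi (ae_of_all _ fun _ => Real.sqrt_nonneg _)).symm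
    _ ≤ ENNReal.ofReal (Real.exp (-((1 - 12 * |β'|) * (t : ℝ))) * Real.sqrt (torusRiemannDistSq (fundamentalLatticeRep 2) Q Q')) :=
        ENNReal.ofReal_le_ofReal hcost

/-- ★★★★ **Shen–Zhu–Zhu's Theorem 4.2 (4.5) in the Literature's conclusion shape, `W₁` version.**  For every `L` and `|β'| < 1/12`:
`SZZDiracContraction (fundamentalLatticeRep 2) 3 L β' ((1 − 12|β'|)/2) ρ_L` — for ANY two strong solutions of the `SU(2)` lattice Langevin SDE on
`(ℤ/L)³` started at `Q`, `Q̄` (each on its own filtered probability space), the coupling infimum of `E ρ_L(U_t, U'_t)` is at most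
`e^(−2Kt)·ρ_L(Q,Q̄)` with `2K = 1 − 12|β'| ≥ K_𝒮 = 1 − 16|β'|`, uniformly in the volume.  (Printed: the same with cost `ρ_L²`, i.e. `W₂`; here `W₁`.)
[cite: ShenZhuZhu2022, Theorem 4.2 (4.5)] [cite: Villani2003, Thm. 1.14] -/
theorem szzDiracContraction_W1_su2 (L : ℕ) [NeZero L] (β' : ℝ) (hβ : |β'| < 1 / 12) :
    SZZDiracContraction (fundamentalLatticeRep 2) 3 L β' ((1 - 12 * |β'|) / 2)
      (fun U U' : GaugeConfig 3 L (Matrix.specialUnitaryGroup (Fin 2) ℂ) => Real.sqrt (torusRiemannDistSq (fundamentalLatticeRep 2) U U')) := by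
  intro Ω _ P _ W hW U Q hU0 hU Ω' _ P' _ W' hW' U' Q' hU'0 hU' t
  obtain ⟨κ, hκ, -, hreal⟩ := exists_transitionKernel L β'
  haveI := hκ
  rw [← hreal t Q Ω P W hW U hU0 hU, ← hreal t Q' Ω' P' W' hW' U' hU'0 hU']
  have hexp : Real.exp (-2 * ((1 - 12 * |β'|) / 2) * (t : ℝ)) = Real.exp (-((1 - 12 * |β'|) * (t : ℝ))) := by
    congr 1; ring
  rw [hexp]
  exact wilson_szzWasserstein_W1_contraction L Q Q' t β' hβ κ hreal

/-- ★★★ **`W₁(νP_t, ν'P_t) ≤ e^(−(1−12|β'|)t)·W₁(ν, ν')` for arbitrary initial laws** (both sides as the coupling infimum `szzWassersteinSq ρ_L`):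
Kantorovich–Rubinstein for the time-`t` laws and the coupling form of G57 for the initial laws. [cite: ShenZhuZhu2022, Theorem 4.2 (4.5)] [cite: Villani2003, Thm. 1.14] -/
theorem wilson_szzWasserstein_W1_contraction_of_initialLaws (L : ℕ) [NeZero L]
    (ν ν' : Measure (GaugeConfig 3 L (Matrix.specialUnitaryGroup (Fin 2) ℂ))) [IsProbabilityMeasure ν] [IsProbabilityMeasure ν'] (t : ℝ≥0) (β' : ℝ) (hβ : |β'| < 1 / 12)
    (κ : ℝ≥0 → Kernel (GaugeConfig 3 L (Matrix.specialUnitaryGroup (Fin 2) ℂ))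
      (GaugeConfig 3 L (Matrix.specialUnitaryGroup (Fin 2) ℂ))) [∀ t, IsMarkovKernel (κ t)]
    (hreal : ∀ (t : ℝ≥0) (x : GaugeConfig 3 L (Matrix.specialUnitaryGroup (Fin 2) ℂ))
        (Ω : Type) [MeasurableSpace Ω] (P : Measure Ω) [IsProbabilityMeasure P]
        (W : ℝ≥0 → Ω → (Edge 3 L × NoiseIdx 2 → ℝ)) (hW : IsFlatBrownian W P)
        (U : ℝ≥0 → Ω → GaugeConfig 3 L (Matrix.specialUnitaryGroup (Fin 2) ℂ)),
        (∀ ω, U 0 ω = x) →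
        (latticeLangevinDynamics (fundamentalLatticeRep 2) β').IsSolution (fundamentalRep (Fin 2))
          hW.natFiltration P W U →
        κ t x = P.map (U t))
    :
    szzWassersteinSq (fun U U' : GaugeConfig 3 L (Matrix.specialUnitaryGroup (Fin 2) ℂ) => Real.sqrt (torusRiemannDistSq (fundamentalLatticeRep 2) U U')) (κ t ∘ₘ ν) (κ t ∘ₘ ν') ≤
      ENNReal.ofReal (Real.exp (-((1 - 12 * |β'|) * (t : ℝ)))) *
        szzWassersteinSq (fun U U' : GaugeConfig 3 L (Matrix.specialUnitaryGroup (Fin 2) ℂ) => Real.sqrt (torusRiemannDistSq (fundamentalLatticeRep 2) U U')) ν ν' := by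
  classical
  haveI := secondCountableTopology_su2
  haveI := borelSpace_config L
  haveI : IsProbabilityMeasure (κ t ∘ₘ ν) := by
    constructor; rw [Measure.bind_apply MeasurableSet.univ (κ t).measurable.aemeasurable]; simp
  haveI : IsProbabilityMeasure (κ t ∘ₘ ν') := by
    constructor; rw [Measure.bind_apply MeasurableSet.univ (κ t).measurable.aemeasurable]; simp
  have hzero : ∀ x y : GaugeConfig 3 L (Matrix.specialUnitaryGroup (Fin 2) ℂ), Real.sqrt (torusRiemannDistSq (fundamentalLatticeRep 2) x y) = 0 ↔ x = y := fun x y => by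
    have h0 : 0 ≤ torusRiemannDistSq (fundamentalLatticeRep 2) x y := by
      unfold torusRiemannDistSq; exact Finset.sum_nonneg fun _ _ => sq_nonneg _
    rw [Real.sqrt_eq_zero h0, torusRiemannDistSq_two_eq_zero_iff]
  have hself : ∀ x : GaugeConfig 3 L (Matrix.specialUnitaryGroup (Fin 2) ℂ), Real.sqrt (torusRiemannDistSq (fundamentalLatticeRep 2) x x) = 0 := fun x => (hzero x x).2 rfl
  have hcomm : ∀ x y : GaugeConfig 3 L (Matrix.specialUnitaryGroup (Fin 2) ℂ), Real.sqrt (torusRiemannDistSq (fundamentalLatticeRep 2) x y) = Real.sqrt (torusRiemannDistSq (fundamentalLatticeRep 2) y x) :=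
    fun x y => by rw [torusRiemannDistSq_two_comm]
  have htri : ∀ x y z : GaugeConfig 3 L (Matrix.specialUnitaryGroup (Fin 2) ℂ), Real.sqrt (torusRiemannDistSq (fundamentalLatticeRep 2) x z) ≤
      Real.sqrt (torusRiemannDistSq (fundamentalLatticeRep 2) x y) + Real.sqrt (torusRiemannDistSq (fundamentalLatticeRep 2) y z) :=
    fun x y z => sqrt_torusRiemannDistSq_two_triangle x y z
  have hcont2 : Continuous fun p : (GaugeConfig 3 L (Matrix.specialUnitaryGroup (Fin 2) ℂ)) × (GaugeConfig 3 L (Matrix.specialUnitaryGroup (Fin 2) ℂ)) => Real.sqrt (torusRiemannDistSq (fundamentalLatticeRep 2) p.1 p.2) :=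
    Real.continuous_sqrt.comp continuous_torusRiemannDistSq_two
  letI : MetricSpace (GaugeConfig 3 L (Matrix.specialUnitaryGroup (Fin 2) ℂ)) :=
    { __ := PseudoMetricSpace.ofDistTopology (fun x y : GaugeConfig 3 L (Matrix.specialUnitaryGroup (Fin 2) ℂ) => Real.sqrt (torusRiemannDistSq (fundamentalLatticeRep 2) x y))
        hself hcomm htri isOpen_iff_riemannDist_ball,
      eq_of_dist_eq_zero := fun {x y} h => (hzero x y).1 h }
  let c : C((GaugeConfig 3 L (Matrix.specialUnitaryGroup (Fin 2) ℂ)) × (GaugeConfig 3 L (Matrix.specialUnitaryGroup (Fin 2) ℂ)), ℝ) := ⟨fun p => Real.sqrt (torusRiemannDistSq (fundamentalLatticeRep 2) p.1 p.2), hcont2⟩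
  have hc : Literature.MeasureTheory.OptimalTransport.IsMetricCost c :=
    ⟨fun x => hself x, fun x y => hcomm x y, fun x y z => htri x y z⟩
  obtain ⟨π, ζ, hπ, hζ, heq, -, -, -⟩ :=
    Literature.MeasureTheory.OptimalTransport.exists_isCoupling_isKRPotential (μ := κ t ∘ₘ ν) (ν := κ t ∘ₘ ν') hc (by rw [measure_univ, measure_univ])
  have hlip : ∀ P P' : GaugeConfig 3 L (Matrix.specialUnitaryGroup (Fin 2) ℂ), |ζ P' - ζ P| ≤ 1 * Real.sqrt (torusRiemannDistSq (fundamentalLatticeRep 2) P P') := fun P P' => by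
    rw [one_mul, hcomm]
    exact hζ.abs_sub_le hc P' P
  have hprob : IsProbabilityMeasure π := by
    constructor
    have h1 : π.map Prod.fst Set.univ = 1 := by rw [hπ.map_fst]; exact measure_univ
    rwa [Measure.map_apply measurable_fst MeasurableSet.univ, Set.preimage_univ] at h1
  haveI := hprob
  have hπ' : Literature.Geometry.Riemannian.IsCoupling (κ t ∘ₘ ν) (κ t ∘ₘ ν') π := ⟨hprob, hπ.map_fst, hπ.map_snd⟩
  have hρi : Integrable (fun z : (GaugeConfig 3 L (Matrix.specialUnitaryGroup (Fin 2) ℂ)) × (GaugeConfig 3 L (Matrix.specialUnitaryGroup (Fin 2) ℂ)) => Real.sqrt (torusRiemannDistSq (fundamentalLatticeRep 2) z.1 z.2)) π :=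
    hcont2.integrable_of_hasCompactSupport (HasCompactSupport.of_compactSpace _)
  -- the left-hand side is at most `∫ c dπ = ∫ζ d(κ_t∘ν) − ∫ζ d(κ_t∘ν')`
  have hlhs : szzWassersteinSq (fun U U' : GaugeConfig 3 L (Matrix.specialUnitaryGroup (Fin 2) ℂ) => Real.sqrt (torusRiemannDistSq (fundamentalLatticeRep 2) U U')) (κ t ∘ₘ ν) (κ t ∘ₘ ν') ≤
      ENNReal.ofReal (∫ x, ζ x ∂(κ t ∘ₘ ν) - ∫ x, ζ x ∂(κ t ∘ₘ ν')) := by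
    rw [← heq]
    calc szzWassersteinSq (fun U U' : GaugeConfig 3 L (Matrix.specialUnitaryGroup (Fin 2) ℂ) => Real.sqrt (torusRiemannDistSq (fundamentalLatticeRep 2) U U')) (κ t ∘ₘ ν) (κ t ∘ₘ ν')
        ≤ ∫⁻ z, ENNReal.ofReal (Real.sqrt (torusRiemannDistSq (fundamentalLatticeRep 2) z.1 z.2)) ∂π := szzWassersteinSq_le _ hπ'
      _ = ENNReal.ofReal (∫ z, Real.sqrt (torusRiemannDistSq (fundamentalLatticeRep 2) z.1 z.2) ∂π) :=
          (ofReal_integral_eq_lintegral_ofReal hρi (ae_of_all _ fun _ => Real.sqrt_nonneg _)).symm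
      _ = ENNReal.ofReal (∫ z, c z ∂π) := rfl
  -- the right-hand side dominates it, coupling by coupling (G57)
  set a : ℝ := Real.exp (-((1 - 12 * |β'|) * (t : ℝ))) with ha
  have ha0 : 0 < a := Real.exp_pos _
  refine hlhs.trans ?_
  unfold szzWassersteinSq
  rw [ENNReal.mul_iInf_of_ne (ENNReal.ofReal_pos.2 ha0).ne' ENNReal.ofReal_ne_top]
  refine le_iInf fun q => ?_
  haveI := q.2.1
  have hρq : Integrable (fun z : (GaugeConfig 3 L (Matrix.specialUnitaryGroup (Fin 2) ℂ)) × (GaugeConfig 3 L (Matrix.specialUnitaryGroup (Fin 2) ℂ)) => Real.sqrt (torusRiemannDistSq (fundamentalLatticeRep 2) z.1 z.2)) (q : Measure _) :=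
    hcont2.integrable_of_hasCompactSupport (HasCompactSupport.of_compactSpace _)
  have hG57 := wilson_W1_contraction_of_coupling L zero_le_one hlip ν ν' q.2 t β' hβ κ hreal
  rw [mul_one] at hG57
  rw [← ofReal_integral_eq_lintegral_ofReal hρq (ae_of_all _ fun _ => Real.sqrt_nonneg _), ← ENNReal.ofReal_mul ha0.le]
  exact ENNReal.ofReal_le_ofReal ((le_abs_self _).trans hG57)

end Summit.QuantumFields.YangMills.Theorems.ColdStartUniversality

end
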